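import Mathlib.GroupTheory.Nilpotent
import Mathlib.GroupTheory.QuotientGroup.Basic
import Mathlib.Algebra.BigOperators.Group.List.Basic
import Mathlib.Algebra.BigOperators.Fin
import Mathlib.Algebra.BigOperators.Ring.Finset
import Literature.Topology.FourManifolds.GroupTrisections
import HarnessLib

/-!
# Level-one glue IV: the contraction identity (helper for stub `stub_levelOneGlue`)

Line `saturated-torsor-descent`, crux `CongruenceShadows.NilpotentShadowsStandard`
(item stmt-SmoothPoincare4-14594).  Pure finite bookkeeping in a commutative group `Z` (in the
application: the centre of `F ⧸ γ₃ F`, `F = FreeGroup (Fin g)`, with `cc v w = ⁅y_v, y_w⁆`):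
for an antisymmetric pairing `cc : Fin g → Fin g → Z`, an alternating integer 3-form `D`, a cut
pattern `ct : Fin g → Bool` with survivors `y_h = (h, !ct h)`, a handle `j` with sign
`s = if ct j then -1 else 1`, and the Johnson values
`gZ (p, q, r) = cz q r ^ P p · cz r p ^ P q · cz p q ^ P r` of the basic realisers at the cut
letter `(j, ct j)` (where the letter pairing `cz` kills cut letters and restricts to `cc` on
survivors, and `P` is the symplectic pairing with `(j, ct j)`), the product over ALL letter triples
`∏_t gZ t ^ E t`, for any exponent `E` restricting on survivor triples to `[h₁<h₂<h₃] D h₁ h₂ h₃`,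
equals the pair product `∏_{v<w} cc v w ^ (s · D j v w)` (`verification_identity`, registered in
closed form as `helper_glueContraction`).  Also: pair products of central elements as products in
the centre (`pp_eq_coe_prod`).  No definitions.
-/

set_option linter.dupNamespace false

open Subgroup Literature.Topology.FourManifolds
open scoped commutatorElement

namespace Summit.SmoothPoincare4.SmoothPoincare4.Theorems.NilpotentShadowsStandard.SaturatedTorsorDescent

section Contraction

variable {Z : Type*} [CommGroup Z] {g : ℕ}

/-- Collapsing the indicator of `j` in the first slot of a triple product. [folklore] -/
theorem prod3_collapse_first (F : Fin g → Fin g → Z) (X : Fin g → Fin g → Fin g → ℤ) (j : Fin g) (s : ℤ) :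
    (∏ h₁, ∏ h₂, ∏ h₃, F h₂ h₃ ^ ((if j = h₁ then s else 0) * X h₁ h₂ h₃)) =
      ∏ v, ∏ w, F v w ^ (s * X j v w) := by
  rw [Finset.prod_eq_single j]
  · simp
  · intro b _ hb
    simp [Ne.symm hb]
  · simp

/-- Collapsing the indicator of `j` in the second slot of a triple product. [folklore] -/
theorem prod3_collapse_second (F : Fin g → Fin g → Z) (X : Fin g → Fin g → Fin g → ℤ) (j : Fin g) (s : ℤ) :
    (∏ h₁, ∏ h₂, ∏ h₃, F h₃ h₁ ^ ((if j = h₂ then s else 0) * X h₁ h₂ h₃)) =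
      ∏ v, ∏ w, F w v ^ (s * X v j w) := by
  refine Finset.prod_congr rfl fun v _ => ?_
  rw [Finset.prod_eq_single j]
  · simp
  · intro b _ hb
    simp [Ne.symm hb]
  · simp

/-- Collapsing the indicator of `j` in the third slot of a triple product. [folklore] -/
theorem prod3_collapse_third (F : Fin g → Fin g → Z) (X : Fin g → Fin g → Fin g → ℤ) (j : Fin g) (s : ℤ) :
    (∏ h₁, ∏ h₂, ∏ h₃, F h₁ h₂ ^ ((if j = h₃ then s else 0) * X h₁ h₂ h₃)) =
      ∏ v, ∏ w, F v w ^ (s * X v w j) := by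
  refine Finset.prod_congr rfl fun v _ => Finset.prod_congr rfl fun w _ => ?_
  rw [Finset.prod_eq_single j]
  · simp
  · intro b _ hb
    simp [Ne.symm hb]
  · simp

/-- The exponent bookkeeping of the contraction identity. [folklore] -/
theorem contraction_exponent (D : Fin g → Fin g → Fin g → ℤ)
    (hD1 : ∀ a b c, D b a c = -D a b c) (hD2 : ∀ a b c, D a c b = -D a b c) (j v w : Fin g) (s : ℤ) :
    s * (if j < v ∧ v < w then D j v w else 0) + -(s * (if v < j ∧ j < w then D v j w else 0)) +
      s * (if v < w ∧ w < j then D v w j else 0) = if v < w then s * D j v w else 0 := by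
  rw [show D v j w = -D j v w from hD1 j v w,
    show D v w j = D j v w by rw [hD2 v j w, hD1 j v w, neg_neg]]
  have h3 : ∀ c, D j j c = 0 := fun c => by have := hD1 j j c; omega
  have h4 : ∀ b, D j b j = 0 := fun b => by have := hD2 j j b; have := h3 b; omega
  rcases lt_trichotomy j v with hjv | hjv | hjv
  · -- `j < v`
    have h1 : ¬ (v < j ∧ j < w) := fun h => lt_asymm hjv h.1
    have h2 : ¬ (v < w ∧ w < j) := fun h => lt_asymm hjv (h.1.trans h.2)
    by_cases hvw : v < w
    · simp only [if_pos (And.intro hjv hvw), if_neg h1, if_neg h2, if_pos hvw]; ring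
    · simp only [if_neg (fun h : j < v ∧ v < w => hvw h.2), if_neg h1, if_neg h2, if_neg hvw]; ring
  · -- `j = v`
    subst hjv
    have h1 : ¬ (j < j ∧ j < w) := fun h => lt_irrefl _ h.1
    have h2 : ¬ (j < w ∧ w < j) := fun h => lt_asymm h.1 h.2
    simp only [if_neg h1, if_neg h2, h3]
    split_ifs <;> ring
  · -- `v < j`
    have h1 : ¬ (j < v ∧ v < w) := fun h => lt_asymm hjv h.1
    rcases lt_trichotomy j w with hjw | hjw | hjw
    · have h2 : ¬ (v < w ∧ w < j) := fun h => lt_asymm hjw h.2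
      simp only [if_neg h1, if_pos (And.intro hjv hjw), if_neg h2, if_pos (hjv.trans hjw)]; ring
    · subst hjw
      have h2 : ¬ (v < j ∧ j < j) := fun h => lt_irrefl _ h.2
      simp only [if_neg h1, if_neg h2, if_pos hjv, h4]; ring
    · have h2 : ¬ (v < j ∧ j < w) := fun h => lt_asymm hjw h.2
      by_cases hvw : v < w
      · simp only [if_neg h1, if_neg h2, if_pos (And.intro hvw hjw), if_pos hvw]; ring
      · simp only [if_neg h1, if_neg h2, if_neg (fun h : v < w ∧ w < j => hvw h.1), if_neg hvw]; ring

/-- **The contraction identity.** For an antisymmetric pairing `cc` and an alternating 3-form `D`: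
contracting `D`, spread over the three cyclic positions with the indicator of the handle `j` and
the sign `s`, gives the pair product of `s · D j`. [folklore] -/
theorem contraction_identity (cc : Fin g → Fin g → Z) (hanti : ∀ v w, cc w v = (cc v w)⁻¹)
    (D : Fin g → Fin g → Fin g → ℤ) (hD1 : ∀ a b c, D b a c = -D a b c)
    (hD2 : ∀ a b c, D a c b = -D a b c) (j : Fin g) (s : ℤ) :
    (∏ h₁, ∏ h₂, ∏ h₃, (cc h₂ h₃ ^ (if j = h₁ then s else 0) * cc h₃ h₁ ^ (if j = h₂ then s else 0) *
        cc h₁ h₂ ^ (if j = h₃ then s else 0)) ^ (if h₁ < h₂ ∧ h₂ < h₃ then D h₁ h₂ h₃ else 0)) =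
      ∏ v, ∏ w, if v < w then cc v w ^ (s * D j v w) else 1 := by
  set X : Fin g → Fin g → Fin g → ℤ := fun h₁ h₂ h₃ => if h₁ < h₂ ∧ h₂ < h₃ then D h₁ h₂ h₃ else 0 with hX
  have step1 : (∏ h₁, ∏ h₂, ∏ h₃, (cc h₂ h₃ ^ (if j = h₁ then s else 0) *
      cc h₃ h₁ ^ (if j = h₂ then s else 0) * cc h₁ h₂ ^ (if j = h₃ then s else 0)) ^ X h₁ h₂ h₃) =
      (∏ h₁, ∏ h₂, ∏ h₃, cc h₂ h₃ ^ ((if j = h₁ then s else 0) * X h₁ h₂ h₃)) *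
      (∏ h₁, ∏ h₂, ∏ h₃, cc h₃ h₁ ^ ((if j = h₂ then s else 0) * X h₁ h₂ h₃)) *
      (∏ h₁, ∏ h₂, ∏ h₃, cc h₁ h₂ ^ ((if j = h₃ then s else 0) * X h₁ h₂ h₃)) := by
    simp only [← Finset.prod_mul_distrib, mul_zpow, ← zpow_mul]
  rw [step1, prod3_collapse_first, prod3_collapse_second, prod3_collapse_third,
    ← Finset.prod_mul_distrib, ← Finset.prod_mul_distrib]
  refine Finset.prod_congr rfl fun v _ => ?_
  rw [← Finset.prod_mul_distrib, ← Finset.prod_mul_distrib]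
  refine Finset.prod_congr rfl fun w _ => ?_
  rw [hanti v w, inv_zpow', ← zpow_add, ← zpow_add, hX]
  simp only
  rw [contraction_exponent D hD1 hD2 j v w s]
  split_ifs
  · rfl
  · exact zpow_zero _

/-- **Re-indexing letter triples by handle triples.** A function of letter triples vanishing as
soon as one letter is a cut letter is summed over the survivor triples. [folklore] -/
theorem prod_letters_eq_prod_handles {M : Type*} [CommMonoid M] (ct : Fin g → Bool)
    (G : (Fin g × Bool) × (Fin g × Bool) × (Fin g × Bool) → M)
    (hG : ∀ t, (t.1.2 = ct t.1.1 ∨ t.2.1.2 = ct t.2.1.1 ∨ t.2.2.2 = ct t.2.2.1) → G t = 1) :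
    ∏ t, G t = ∏ h₁, ∏ h₂, ∏ h₃, G ((h₁, !ct h₁), (h₂, !ct h₂), (h₃, !ct h₃)) := by
  classical
  set Y : Fin g × Fin g × Fin g → (Fin g × Bool) × (Fin g × Bool) × (Fin g × Bool) :=
    fun h => ((h.1, !ct h.1), (h.2.1, !ct h.2.1), (h.2.2, !ct h.2.2)) with hY
  have hYinj : Function.Injective Y := by
    rintro ⟨a, b, c⟩ ⟨a', b', c'⟩ h
    simp only [hY, Prod.mk.injEq] at h
    obtain ⟨⟨rfl, -⟩, ⟨rfl, -⟩, ⟨rfl, -⟩⟩ := h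
    rfl
  have hrhs : (∏ h₁, ∏ h₂, ∏ h₃, G ((h₁, !ct h₁), (h₂, !ct h₂), (h₃, !ct h₃))) =
      ∏ h : Fin g × Fin g × Fin g, G (Y h) := by
    rw [Fintype.prod_prod_type]
    refine Finset.prod_congr rfl fun a _ => ?_
    rw [Fintype.prod_prod_type]
  rw [hrhs, ← Finset.prod_image fun x _ y _ h => hYinj h]
  symm
  refine Finset.prod_subset (Finset.subset_univ _) fun t _ ht => hG t ?_
  by_contra hne
  simp only [not_or] at hne
  obtain ⟨h1, h2, h3⟩ := hne
  refine ht (Finset.mem_image.2 ⟨(t.1.1, t.2.1.1, t.2.2.1), Finset.mem_univ _, ?_⟩)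
  obtain ⟨⟨a, pa⟩, ⟨b, pb⟩, ⟨c, pc⟩⟩ := t
  simp only [hY] at h1 h2 h3 ⊢
  have e1 : (!ct a) = pa := by revert h1; cases pa <;> cases ct a <;> decide
  have e2 : (!ct b) = pb := by revert h2; cases pb <;> cases ct b <;> decide
  have e3 : (!ct c) = pc := by revert h3; cases pc <;> cases ct c <;> decide
  rw [e1, e2, e3]

/-- The symplectic pairing of the cut letter `(j, ct j)` with a cut letter vanishes. [folklore] -/
theorem pairing_cut_eq_zero (ct : Fin g → Bool) (j : Fin g) (PZ : Fin g × Bool → ℤ)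
    (hPZ : ∀ p, PZ p = if j = p.1 ∧ ct j = false ∧ p.2 = true then 1
      else if j = p.1 ∧ ct j = true ∧ p.2 = false then -1 else 0)
    (p : Fin g × Bool) (hp : p.2 = ct p.1) : PZ p = 0 := by
  rw [hPZ]
  obtain ⟨h, b⟩ := p
  simp only at hp ⊢
  subst hp
  by_cases hj : j = h
  · subst hj; cases ct j <;> simp
  · simp [hj]

/-- The symplectic pairing of the cut letter `(j, ct j)` with the survivor of handle `h` is the
sign `s = if ct j then -1 else 1` if `h = j` and `0` otherwise. [folklore] -/
theorem pairing_survivor (ct : Fin g → Bool) (j : Fin g) (PZ : Fin g × Bool → ℤ)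
    (hPZ : ∀ p, PZ p = if j = p.1 ∧ ct j = false ∧ p.2 = true then 1
      else if j = p.1 ∧ ct j = true ∧ p.2 = false then -1 else 0)
    (h : Fin g) : PZ (h, !ct h) = if j = h then (if ct j then (-1 : ℤ) else 1) else 0 := by
  rw [hPZ]
  by_cases hj : j = h
  · subst hj; cases ct j <;> simp
  · simp [hj]

/-- The Johnson value of a basic realiser at the cut letter vanishes unless all three letters of
the triple are survivors. [folklore] -/
theorem gZ_eq_one_of_cut (ct : Fin g → Bool) (j : Fin g) (PZ : Fin g × Bool → ℤ)
    (hPZ : ∀ p, PZ p = if j = p.1 ∧ ct j = false ∧ p.2 = true then 1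
      else if j = p.1 ∧ ct j = true ∧ p.2 = false then -1 else 0)
    (cz : Fin g × Bool → Fin g × Bool → Z)
    (hcz : ∀ p q, (p.2 = ct p.1 ∨ q.2 = ct q.1) → cz p q = 1)
    (t : (Fin g × Bool) × (Fin g × Bool) × (Fin g × Bool))
    (ht : t.1.2 = ct t.1.1 ∨ t.2.1.2 = ct t.2.1.1 ∨ t.2.2.2 = ct t.2.2.1) :
    cz t.2.1 t.2.2 ^ PZ t.1 * cz t.2.2 t.1 ^ PZ t.2.1 * cz t.1 t.2.1 ^ PZ t.2.2 = 1 := by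
  rcases ht with hp | hq | hr
  · rw [pairing_cut_eq_zero ct j PZ hPZ _ hp, hcz _ _ (Or.inr hp), hcz _ _ (Or.inl hp)]
    simp
  · rw [pairing_cut_eq_zero ct j PZ hPZ _ hq, hcz _ _ (Or.inl hq), hcz _ _ (Or.inr hq)]
    simp
  · rw [pairing_cut_eq_zero ct j PZ hPZ _ hr, hcz _ _ (Or.inr hr), hcz _ _ (Or.inl hr)]
    simp

/-- **The verification identity** (see the module docstring). [folklore] -/
theorem verification_identity (cc : Fin g → Fin g → Z) (hanti : ∀ v w, cc w v = (cc v w)⁻¹)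
    (ct : Fin g → Bool) (j : Fin g) (PZ : Fin g × Bool → ℤ)
    (hPZ : ∀ p, PZ p = if j = p.1 ∧ ct j = false ∧ p.2 = true then 1
      else if j = p.1 ∧ ct j = true ∧ p.2 = false then -1 else 0)
    (cz : Fin g × Bool → Fin g × Bool → Z)
    (hcz : ∀ p q, (p.2 = ct p.1 ∨ q.2 = ct q.1) → cz p q = 1)
    (hcz' : ∀ v w, cz (v, !ct v) (w, !ct w) = cc v w)
    (D : Fin g → Fin g → Fin g → ℤ) (hD1 : ∀ a b c, D b a c = -D a b c)
    (hD2 : ∀ a b c, D a c b = -D a b c)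
    (E : (Fin g × Bool) × (Fin g × Bool) × (Fin g × Bool) → ℤ)
    (hE : ∀ h₁ h₂ h₃, E ((h₁, !ct h₁), (h₂, !ct h₂), (h₃, !ct h₃)) =
      if h₁ < h₂ ∧ h₂ < h₃ then D h₁ h₂ h₃ else 0) :
    (∏ t : (Fin g × Bool) × (Fin g × Bool) × (Fin g × Bool),
      (cz t.2.1 t.2.2 ^ PZ t.1 * cz t.2.2 t.1 ^ PZ t.2.1 * cz t.1 t.2.1 ^ PZ t.2.2) ^ E t) =
      ∏ v, ∏ w, if v < w then cc v w ^ ((if ct j then (-1 : ℤ) else 1) * D j v w) else 1 := by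
  rw [prod_letters_eq_prod_handles ct _ fun t ht => by
    rw [gZ_eq_one_of_cut ct j PZ hPZ cz hcz t ht, one_zpow]]
  simp only [hcz', pairing_survivor ct j PZ hPZ, hE]
  exact contraction_identity cc hanti D hD1 hD2 j _

end Contraction

/-! ## Pair products of central elements as products in the centre -/

section Centre

open scoped IsMulCommutative

variable {M : Type*} [Group M] {n : ℕ}

/-- A pair product of central elements is the image of the corresponding `Finset` product in the
(commutative) centre. [folklore] -/
theorem pp_eq_coe_prod (c : Fin n → Fin n → center M) (e : Fin n → Fin n → ℤ) :
    ((List.finRange n).map (fun v => ((List.finRange n).map (fun w =>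
      if v < w then (c v w : M) ^ (e v w) else 1)).prod)).prod =
    ((∏ v, ∏ w, if v < w then c v w ^ (e v w) else 1 : center M) : M) := by
  rw [Fin.prod_univ_def, Submonoid.coe_list_prod, List.map_map]
  refine congrArg List.prod (List.map_congr_left fun v _ => ?_)
  rw [Function.comp_apply, Fin.prod_univ_def, Submonoid.coe_list_prod, List.map_map]
  refine congrArg List.prod (List.map_congr_left fun w _ => ?_)
  rw [Function.comp_apply]
  split_ifs
  · exact (Subgroup.coe_zpow _ _ _).symm
  · rfl

/-- A list product over `Finset.toList` is the `Finset` product. [folklore] -/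
theorem prod_map_toList {ι N : Type*} [CommMonoid N] [DecidableEq ι] (s : Finset ι) (f : ι → N) :
    (s.toList.map f).prod = ∏ x ∈ s, f x := by
  rw [← List.prod_toFinset f (Finset.nodup_toList s), Finset.toList_toFinset]

/-- The image in `M` of a list product of powers in the centre. [folklore] -/
theorem coe_list_prod_zpow {ι : Type*} (l : List ι) (f : ι → center M) (e : ι → ℤ) :
    (l.map fun i => ((f i : M)) ^ e i).prod = (((l.map fun i => f i ^ e i).prod : center M) : M) := by
  rw [Submonoid.coe_list_prod, List.map_map]
  refine congrArg List.prod (List.map_congr_left fun i _ => ?_)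
  rw [Function.comp_apply, Subgroup.coe_zpow]

end Centre

/-! ## Registered helper -/

/-- **Registered helper `helper_glueContraction`** (sub-goal of the lead's skeleton for crux
stmt-SmoothPoincare4-14594): the contraction identity in a commutative group, in closed form.
[folklore] -/
theorem helper_glueContraction : ∀ (Z : Type) [CommGroup Z] (g : ℕ) (cc : Fin g → Fin g → Z), (∀ v w, cc w v = (cc v w)⁻¹) → ∀ (D : Fin g → Fin g → Fin g → ℤ), (∀ a b c, D b a c = -D a b c) → (∀ a b c, D a c b = -D a b c) → ∀ (j : Fin g) (s : ℤ), (∏ h₁, ∏ h₂, ∏ h₃, (cc h₂ h₃ ^ (if j = h₁ then s else 0) * cc h₃ h₁ ^ (if j = h₂ then s else 0) * cc h₁ h₂ ^ (if j = h₃ then s else 0)) ^ (if h₁ < h₂ ∧ h₂ < h₃ then D h₁ h₂ h₃ else 0)) = ∏ v, ∏ w, if v < w then cc v w ^ (s * D j v w) else 1 :=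
  fun _ _ _ cc hanti D hD1 hD2 j s => contraction_identity cc hanti D hD1 hD2 j s

end Summit.SmoothPoincare4.SmoothPoincare4.Theorems.NilpotentShadowsStandard.SaturatedTorsorDescent
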